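import Summits.BirchSwinnertonDyer.BirchSwinnertonDyer.Theorems.SignedLowerHalvesSmallImageLowerHalfBothSignsRttD2SeqSemilocPhi
import Summits.BirchSwinnertonDyer.BirchSwinnertonDyer.Theorems.SignedLowerHalvesSmallImageLowerHalfBothSignsRttD2SeqSemilocTower
import Summits.BirchSwinnertonDyer.BirchSwinnertonDyer.Theorems.SignedLowerHalvesSmallImageLowerHalfBothSignsRttD2SeqLocalDualO
import Literature.NumberTheory.GaloisRepresentations.ShapiroLocalDualityOpenSubgroup
import HarnessLib

/-!
# Route `SignedLowerHalves`, crux L `SmallImageLowerHalfBothSigns` (stmt-BirchSwinnertonDyer-23599), line `rtt_w3` v30 — stub S3β″ (`stub_junctionPT_ns`, row J4′,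
# Poitou–Tate half), brick N2d (γ): `Φ h = 0` ⇒ THE LEVELWISE ORTHOGONALITY (i) OF T4 — every test class of the depleted Poitou–Tate existence statement
# (`c ∈ H¹(U_n, M[p^k])` unramified off `S₀ ∪ {v}`, `v`-orthogonal) IS the torsion-level lift of a `v`-STRICT Selmer class over `K_∞`, on which `Φ h` is `Σ_w ⟨proj h_w, semilocDual c⟩_w / p^k`

WIDTH seat `bsd-line-slh-p3-w3` g26 under LEAD `cruxlead-stmt-BirchSwinnertonDyer-23599` g14 (cell `bsd-ssimc`); helper `--supports stmt-BirchSwinnertonDyer-23599`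
(design memo `Lines/rtt_w3-DESIGN-S3beta-w3-g25.md`, rev 4 §6 RECIPE N2d (γ)). PURE THEOREMS; no definition, no named fact, no instance, no `sorry`. Pattern: g24's H5 `horth_of_hq`
(`…J3HControl`, p805395) at `v`, simplified: the test classes are LOCALLY TRIVIAL at `v` (not merely in the local condition), so no deeper layer is needed.
HONEST FRAMING: with (α)/(β) this completes brick N2 of S3β″ (the kernel hypothesis `hPT` of T5 now follows from T4, see `exists_semilocMap_eq_of_phiLocImage_eq_zero`); the local count N5
(`λ(Λ_𝒪/(E)) ≤ λ(H′)`, finiteness/torsion of `Π 𝐇¹_{Iw,w}`) remains; nothing about S3β″, S3α′, crux L or BSD is proved; all remain OPEN and are proved for NO curve.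

WHAT (local action at `v` = `localAction`, pin `rfl`, as in the skeleton).
* (γ0) ★ `forall_locH1Layer_conjH1_eq_zero_of_forall_semilocPairNK_eq_zero`: `v`-orthogonality of `c` to ALL of `Lloc_v(n,k)` ⇒ `semilocDual_v c = 0` (perfectness of THE canonical local
  Tate pairing, `LocalInvariants.canonical_isPerfect`) ⇒ `res_v(Sh c) = 0` (`Ψ` bijective: `coindTateDualHom_bijective` + `bijective_cohomologyMap_of_bijective_of_discrete`) ⇒
  `loc_{n,v}(conj_δ c) = 0` for every `δ` (Mackey criterion `map_restrict_eq_zero_iff_forall_conjMap_one`, forward direction).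
* (γ1–γ3) ★★★ `sum_semilocPairNK_eq_zero_of_phiLocImage_eq_zero`: then `torsToH1 c ∈ Sel^{ε,S₀}_{sat}(K_n)` (unramified conditions: g24 `resOfLe_torsToH1_mem_unramifiedOutside`;
  signed-saturated condition at `v ∋ p` for all conjugates: the ZERO local class, g24 `mem_localKummerTransportSat_of_locH1Layer_mem`), its restriction `s` to `K_∞` is `v`-strict, and
  `Φ h [s] = Σ_{w∈S₀} ⟨proj_{n,k} h_w, semilocDual c⟩_w / p^k` (N2d (β) `phiLocImage_mk_eq_sum_semilocPairNKQ`); `ℤ/p^k ↪ ℚ/ℤ`.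
* ★★★ `exists_semilocMap_eq_of_phiLocImage_eq_zero` — T5's kernel hypothesis `hPT` from T4 (`exists_forall_semilocMap_eq_of_forall_orth`, p812108): an `(S₀ ∖ P)`-unramified family
  `h ∈ Π_{w∈S₀} 𝐇¹_{Iw,w}` with `Φ h = 0` is `sloc_{S₀} b`, `b ∈ I.H`.
References: [MilneADT2006] I Cor. 2.3, Thm. 4.10 (b); [NeukirchSchmidtWingberg2008] I §6 (1.6.4)–(1.6.5), (7.2.6), (8.6.2); [Kobayashi2003] Def. 1.1, Thm. 7.3 i); [Rubin2000] Thm. 1.7.3, §4.2, App. B.3;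
[GreenbergVatsal2000] §2 pp. 16–17.
-/

set_option autoImplicit false
set_option linter.dupNamespace false -- D-0017: single-problem summit, the namespace repeats the problem name by design
noncomputable section

open scoped Classical
open CategoryTheory Function NumberField IsDedekindDomain Field

namespace Summit.BirchSwinnertonDyer.BirchSwinnertonDyer.Theorems.SmallImageRttD2Seq

open Literature.NumberTheory.GaloisRepresentations Literature.NumberTheory.GaloisCohomology Literature.NumberTheory.EllipticCurves
  Literature.NumberTheory.EllipticCurves.IwasawaDual Literature.NumberTheory.EllipticCurves.GreenbergVatsal2000 Literature.NumberTheory.EllipticCurves.Kobayashi2003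
  Literature.NumberTheory.ComplexMultiplication.EllipticUnits Literature.NumberTheory.ComplexMultiplication.EllipticUnits.JohnsonLeungKings2011
  Literature.NumberTheory.GaloisRepresentations.DiscreteGaloisModule Literature.NumberTheory.GaloisCohomology.PoitouTateFinite
  Literature.AnabelianGeometry.AbsoluteAnabelian.Prop121vii
  Summit.BirchSwinnertonDyer.BirchSwinnertonDyer.Theorems.SmallImageRttD2J1 Summit.BirchSwinnertonDyer.BirchSwinnertonDyer.Theorems.SmallImageCharSignedSelmer

section Kernel

variable {K : Type} [Field K] [NumberField K] {p : ℕ} [Fact p.Prime] (S : Set (PadicAlgCl p)) [FiniteDimensional ℚ_[p] (padicCoeffField S)] (κ : ZpExtension K p)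
  (γ : absoluteGaloisGroup K) (θ' : absoluteGaloisGroup K →ₜ* (padicCoeffIntegers S)ˣ) (P : Set (HeightOneSpectrum (𝓞 K))) (v : HeightOneSpectrum (𝓞 K))
  (M : Type) [AddCommGroup M] [TopologicalSpace M] [DiscreteTopology M] [DistribMulAction (absoluteGaloisGroup K) M] [Module (padicCoeffIntegers S) M]
  (hstabK : ∀ m : M, IsOpen (MulAction.stabilizer (absoluteGaloisGroup K) m : Set (absoluteGaloisGroup K)))
  (PG : ∀ k : ℕ, ContPairing (coeffRepK S θ' P k).toTopRep (torsRep M hstabK p k).toTopRep (mu K (p ^ k)).toTopRep)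

omit [Module (padicCoeffIntegers S) M] in
/-- **(γ0) `v`-orthogonal test classes are locally trivial at `v`, at every conjugate.** If `⟨a, semilocDual c⟩_v = 0` for EVERY `a ∈ Lloc_v(n,k)` (the local level pairing being perfect on
`M[p^k]`), then `loc_{n,v}(conj_δ c) = 0` in `H¹(U_{n,v}, M[p^k])` for every `δ ∈ Γ_K`: perfectness of the canonical local Tate pairing kills `semilocDual c = H¹(Ψ|_v)(res_v(Sh c))`, `Ψ` is
bijective, and the Mackey criterion unfolds `res_v(Sh c) = 0`. [cite: MilneADT2006, Ch. I, Cor. 2.3] [cite: NeukirchSchmidtWingberg2008, I §6 (1.6.4)–(1.6.5), (8.6.2)] -/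
theorem forall_locH1Layer_conjH1_eq_zero_of_forall_semilocPairNK_eq_zero (n k : ℕ) (hperf : Bijective fun a : ↥(torsionPow M p k) ↦ (PG k).toLin.flip a)
    (c : subgroupH1 (κ.layerSubgroup n) ↥(torsionPow M p k)) (hcv : ∀ a : semilocCoh S κ θ' P v n k 1, semilocPairNK S κ θ' P M hstabK PG v n k a c = 0) :
    letI := localAction (closureEmb (K := K) (v.adicCompletion K)) M
    ∀ δ : absoluteGaloisGroup K, locH1Layer κ ↥(torsionPow M p k) v (fun _ _ ↦ rfl) n (conjH1 (κ.layerSubgroup n) ↥(torsionPow M p k) δ c) = 0 := by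
  letI := localAction (closureEmb (K := K) (v.adicCompletion K)) M
  letI := layerQuotFintype κ n
  haveI := finite_oMuCarrier (K := K) S k
  haveI : NeZero (p ^ k) := ⟨pow_ne_zero _ (Fact.out : p.Prime).ne_zero⟩
  haveI : CompactSpace (absoluteGaloisGroup K) := absoluteGaloisGroup_compactSpace K
  haveI : CompactSpace (absoluteGaloisGroup (v.adicCompletion K)) := absoluteGaloisGroup_compactSpace _
  -- (a) `semilocDual_v c = 0` by perfectness of the canonical local Tate pairing
  have hMn : ∀ φ : absoluteGaloisGroup K ⧸ κ.layerSubgroup n → ↥(Representation.invariants ((muTwistO S θ' k).toRepresentation.comp (ramificationSubgroup K P).subtype)),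
      (p ^ k) • φ = 0 := fun φ ↦ funext fun y ↦ by
    rw [Pi.smul_apply, Pi.zero_apply, ← natCast_zsmul]
    exact_mod_cast coeffGSO_torsion S P θ' k (φ y)
  have hinj := ((LocalInvariants.canonical_isPerfect (K := K) (n := p ^ k) v).2
    (DiscreteGaloisModule.coind (coeffRepK S θ' P k) (κ.layerSubgroup n) (κ.isOpen_layerSubgroup n)) hMn).2.1
  have hD : semilocDual S κ θ' P M hstabK PG v n k c = 0 := by
    refine hinj ?_
    rw [map_zero]
    refine AddMonoidHom.ext fun a ↦ ?_
    rw [AddMonoidHom.flip_apply, AddMonoidHom.zero_apply]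
    exact hcv a
  -- (b) `res_v(Sh c) = 0` since `Ψ` is bijective
  have hΨbij : Bijective ((TopRep.resFunctor (resGalOfEmb (closureEmb (K := K) (v.adicCompletion K)) : absoluteGaloisGroup (v.adicCompletion K) →* absoluteGaloisGroup K)).map
      (coindTateDualMor (coeffRepK S θ' P k) (torsRep M hstabK p k) (κ.layerSubgroup n) (pairingB S θ' P M hstabK PG k) (κ.isOpen_layerSubgroup n)
        (pairingB_smul S θ' P M hstabK PG k))).hom :=
    coindTateDualHom_bijective (κ.layerSubgroup n) (pairingB S θ' P M hstabK PG k) (bijective_pairingB_flip S θ' P M hstabK PG k hperf)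
  haveI : DiscreteTopology (TopRep.res (resGalOfEmb (closureEmb (K := K) (v.adicCompletion K)) : absoluteGaloisGroup (v.adicCompletion K) →* absoluteGaloisGroup K)
      (coindFin.{0, 0} (torsRep M hstabK p k).toTopRep (κ.layerSubgroup n))) :=
    inferInstanceAs (DiscreteTopology (absoluteGaloisGroup K ⧸ κ.layerSubgroup n → ↥(torsionPow M p k)))
  haveI : DiscreteTopology (TopRep.res (resGalOfEmb (closureEmb (K := K) (v.adicCompletion K)) : absoluteGaloisGroup (v.adicCompletion K) →* absoluteGaloisGroup K)
      ((DiscreteGaloisModule.coind (coeffRepK S θ' P k) (κ.layerSubgroup n) (κ.isOpen_layerSubgroup n)).tateDual (p ^ k)).toTopRep) :=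
    inferInstanceAs (DiscreteTopology (TateDual K (absoluteGaloisGroup K ⧸ κ.layerSubgroup n →
      ↥(Representation.invariants ((muTwistO S θ' k).toRepresentation.comp (ramificationSubgroup K P).subtype))) (p ^ k)))
  have hres0 : (ContinuousCohomology.map (resGalOfEmb (closureEmb (K := K) (v.adicCompletion K)))
      (𝟙 (TopRep.res (resGalOfEmb (closureEmb (K := K) (v.adicCompletion K)) : absoluteGaloisGroup (v.adicCompletion K) →* absoluteGaloisGroup K)
        (coindFin.{0, 0} (torsRep M hstabK p k).toTopRep (κ.layerSubgroup n)))) 1).hom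
      (shapiroLift (torsRep M hstabK p k).toTopRep (κ.layerSubgroup n) (κ.isOpen_layerSubgroup n) (layerReps_spec κ n) (layerReps_one κ n) c) = 0 := by
    have e := semilocDual_eq_cohomologyMap_map S κ θ' P M hstabK PG v n k c
    rw [hD] at e
    refine (bijective_cohomologyMap_of_bijective_of_discrete _ hΨbij 1).1 ?_
    rw [map_zero]
    exact e.symm
  -- (c) Mackey
  intro δ
  have h := (map_restrict_eq_zero_iff_forall_conjMap_one (torsRep M hstabK p k) (κ.layerSubgroup n) (κ.isOpen_layerSubgroup n)
    (resGalOfEmb (closureEmb (K := K) (v.adicCompletion K))) _).mp hres0 δ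
  rw [shapiroCoindFinAddEquiv_shapiroLift_torsRep, conjMap_torsRep_eq_conjH1] at h
  exact h

variable (hPred : ∀ (k : ℕ) (x : ↥(Representation.invariants ((muTwistO S θ' (k + 1)).toRepresentation.comp (ramificationSubgroup K P).subtype))) (m : ↥(torsionPow M p k)),
    (PG (k + 1)).toLin x (AddSubgroup.inclusion (torsionPow_mono (M := M) (p := p) (Nat.le_succ k)) m) =
      muInclusion K (pow_dvd_pow p (Nat.le_succ k)) ((PG k).toLin (coeffMapO S P θ' (oMuRed S k) (oMuRed_muTwistO S θ' k) x) m))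
  (hM : ∀ m : M, ∃ k : ℕ, p ^ k • m = 0)
  (V : WeierstrassCurve K) (j : V.geomPrimaryTorsion p →+ M) (S₀ : Set (HeightOneSpectrum (𝓞 K))) (hS₀ : S₀.Finite) (ε : ℤˣ)
  (hvp : ((p : ℕ) : 𝓞 K) ∈ v.asIdeal) (hpv : ∀ w : HeightOneSpectrum (𝓞 K), ((p : ℕ) : 𝓞 K) ∈ w.asIdeal → w = v)
  (L : ∀ w : HeightOneSpectrum (𝓞 K), SemilocIwasawaCohomologyDataO S κ γ⁻¹ θ' P w 1) (S₁ : Set (HeightOneSpectrum (𝓞 K))) (hS₀S₁ : S₀ ⊆ S₁)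

include hpv in
/-- ★★★ **(γ) `Φ h = 0` ⇒ THE LEVELWISE ORTHOGONALITY (i) OF T4.** Let `h = (h_w) ∈ Π_w 𝐇¹_{Iw,w}` with `Φ h = 0` on `Sel_{str,v} ⧸ Sel_{str at Σ}` (`v` the only place above `p`, local action
`localAction`). Then for every test class `c ∈ H¹(U_n, M[p^k])` dying on `U_n ⊓ I_𝔓` for all primes `𝔓` over the places `w ∉ S₀ ∪ {v}` and `v`-orthogonal (perfect level `k`):
`Σ_{w∈S₀} ⟨proj_{n,k} h_w, semilocDual c⟩_w = 0`. PROOF: by (γ0) all conjugates of `c` are locally trivial at `v`; hence `c_K := torsToH1 c ∈ Sel^{ε,S₀}_{sat}(K_n, M)` (unramified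
conditions from admissibility; the saturated signed condition at `v` holds for the ZERO local class, all `σ`), `s := res_n c_K ∈ Sel_{str,v}`, and `0 = Φ h [s] = Σ_w ⟨proj h_w, semilocDual c⟩_w / p^k`
with `ℤ/p^k ↪ ℚ/ℤ`. [cite: Kobayashi2003, Def. 1.1, Thm. 7.3 i)] [cite: Rubin2000, Thm. 1.7.3, §4.2] [cite: GreenbergVatsal2000, §2 pp. 16–17] [cite: MilneADT2006, Ch. I, Cor. 2.3] -/
theorem sum_semilocPairNK_eq_zero_of_phiLocImage_eq_zero (h : ∀ w : HeightOneSpectrum (𝓞 K), (L w).H)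
    (hx : letI := localAction (closureEmb (K := K) (v.adicCompletion K)) M
      phiLocImage S κ γ θ' P M hstabK PG hPred hM V j S₀ hS₀ ε v (fun _ _ ↦ rfl) hvp L S₁ hS₀S₁ (fun w : S₀ ↦ h w) = 0)
    (n k : ℕ) (hperf : Bijective fun a : ↥(torsionPow M p k) ↦ (PG k).toLin.flip a) (c : subgroupH1 (κ.layerSubgroup n) ↥(torsionPow M p k))
    (hcur : ∀ w : HeightOneSpectrum (𝓞 K), w ≠ v → w ∉ S₀ → ∀ 𝔓 ∈ w.primesAbove,
      resLe (torsRep M hstabK p k).toTopRep (inf_le_left : κ.layerSubgroup n ⊓ 𝔓.inertia (absoluteGaloisGroup K) ≤ κ.layerSubgroup n) 1 c = 0)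
    (hcv : ∀ a : semilocCoh S κ θ' P v n k 1, semilocPairNK S κ θ' P M hstabK PG v n k a c = 0) :
    ∑ w ∈ hS₀.toFinset, semilocPairNK S κ θ' P M hstabK PG w n k ((L w).proj n k (h w)) c = 0 := by
  letI := localAction (closureEmb (K := K) (v.adicCompletion K)) M
  haveI : NeZero (p ^ k) := ⟨pow_ne_zero _ (Fact.out : p.Prime).ne_zero⟩
  have hloc := forall_locH1Layer_conjH1_eq_zero_of_forall_semilocPairNK_eq_zero S κ θ' P v M hstabK PG n k hperf c hcv
  have hloc1 : locH1Layer κ ↥(torsionPow M p k) v (fun _ _ ↦ rfl) n c = 0 := by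
    have h1 := hloc 1
    rwa [conjH1_one_holds (κ.layerSubgroup n) ↥(torsionPow M p k), AddMonoidHom.id_apply] at h1
  -- (γ1) the `M`-valued class lies in the layer Selmer group
  have hSel : torsToH1 M p (κ.layerSubgroup n) k c ∈ signedTransportSelmerLayerSat κ M (padicCoeffIntegers S) V j S₀ ε n := by
    rw [mem_signedTransportSelmerLayerSat_iff]
    refine ⟨?_, fun w hw σ ↦ ?_⟩
    · have h1 := resOfLe_torsToH1_mem_unramifiedOutside κ v M hstabK S₀ hvp (le_refl n) k c hcur
      rwa [resOfLe_refl_holds, AddMonoidHom.id_apply] at h1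
    · obtain rfl : w = v := hpv w hw
      refine mem_localKummerTransportSat_of_locH1Layer_mem κ w M (padicCoeffIntegers S) (fun _ _ ↦ rfl) V j ε hstabK n ?_
      rw [← torsToH1_conjH1, locH1Layer_torsToH1 κ w M (fun _ _ ↦ rfl) (fun _ _ _ ↦ rfl), hloc σ, map_zero]
      exact zero_mem _
  -- (γ2) its restriction to `K_∞` is a `v`-strict Selmer class
  have hs : resOfLe M (κ.kerSubgroup_le_layerSubgroup n) (torsToH1 M p (κ.layerSubgroup n) k c) ∈ signedTransportSelmerInftySat κ M (padicCoeffIntegers S) V j S₀ ε :=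
    map_resOfLe_signedTransportSelmerLayerSat_le κ M (padicCoeffIntegers S) V j S₀ ε n ⟨_, hSel, rfl⟩
  have hstr : (⟨_, hs⟩ : signedTransportSelmerInftySat κ M (padicCoeffIntegers S) V j S₀ ε) ∈ strictAt κ M (padicCoeffIntegers S) V j S₀ ε v (fun _ _ ↦ rfl) hvp := by
    rw [mem_strictAt_iff]
    change locH1 κ M v (fun _ _ ↦ rfl) (resOfLe M (κ.kerSubgroup_le_layerSubgroup n) (torsToH1 M p (κ.layerSubgroup n) k c)) = 0
    rw [locH1_resOfLe, locH1Layer_torsToH1 κ v M (fun _ _ ↦ rfl) (fun _ _ _ ↦ rfl), hloc1, map_zero, map_zero]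
  -- (γ3) evaluate `Φ h` on it
  have hval := DFunLike.congr_fun hx (QuotientAddGroup.mk ⟨_, hstr⟩)
  rw [AddMonoidHom.zero_apply, phiLocImage_mk_eq_sum_semilocPairNKQ S κ γ θ' P M hstabK PG hPred hM V j S₀ hS₀ ε v (fun _ _ ↦ rfl) hvp L S₁ hS₀S₁ _ _ n k c rfl] at hval
  have hval' : (haveI := hS₀.fintype; ∑ w : S₀, zmodToQmodZ (p ^ k) (semilocPairNK S κ θ' P M hstabK PG w n k ((L w).proj n k (h w)) c)) = 0 := by
    rw [← hval]
    exact Finset.sum_congr rfl fun w _ ↦ (semilocPairNKQ_apply S κ θ' P M hstabK PG w n k _ c).symm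
  rw [← map_sum] at hval'
  have hz := zmodToQmodZ_injective (p ^ k) (hval'.trans (map_zero _).symm)
  rw [← Finset.sum_subtype hS₀.toFinset (fun w ↦ hS₀.mem_toFinset) (fun w ↦ semilocPairNK S κ θ' P M hstabK PG w n k ((L w).proj n k (h w)) c)] at hz
  exact hz

include hpv in
/-- ★★★ **T5's KERNEL HYPOTHESIS `hPT` FROM T4: an `(S₀ ∖ P)`-unramified family `x ∈ Π_{w∈S₀} 𝐇¹_{Iw,w}` with `Φ x = 0` IS a semilocalisation `sloc_{S₀} b`, `b ∈ I.H`.** (Totalise `x` by `0`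
off `S₀`; T4 `exists_forall_semilocMap_eq_of_forall_orth` (p812108) with its levelwise orthogonality (i) supplied by (γ) and (ii) by `hunr`.) With T5 (`lambdaInvariant_le_add_of_ker_subset_range_semilocMapPi`,
p812244) this gives `λ(H′) ≤ λ(Y″) + λ(I.H ⧸ B′)` for `H′` = the `(S₀ ∖ P)`-unramified classes; S3β″ then only needs the local count `λ(Λ_𝒪/(E)) ≤ λ(H′)` (N5). [cite: Rubin2000, Thm. 1.7.3, App. B.3]
[cite: MilneADT2006, Ch. I, Thm. 4.10(b)] [cite: Kobayashi2003, Thm. 7.3 i)] [cite: Kato2004Asterisque, §17.13] -/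
theorem exists_semilocMap_eq_of_phiLocImage_eq_zero [SMulCommClass (absoluteGaloisGroup K) (padicCoeffIntegers S) M]
    {γv : absoluteGaloisGroup (v.adicCompletion K)}
    (𝓛 : letI := localAction (closureEmb (K := K) (v.adicCompletion K)) M
      haveI := smulCommClass_localAction (R := padicCoeffIntegers S) M v
      LayerPairing S M γv κ γ⁻¹ θ' P)
    (hvS₀ : v ∉ S₀) (hvP : v ∈ P) (hP : P.Finite) (hPS₀ : ∀ w ∈ P, w ∉ S₀ → w = v) (hNP : ∀ n, ramificationSubgroup K P ≤ κ.layerSubgroup n)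
    (hperf : ∀ k : ℕ, Bijective fun a : ↥(torsionPow M p k) ↦ (PG k).toLin.flip a) (I : CycIwasawaCohomologyDataO S κ γ⁻¹ θ' P 1) (x : ∀ w : S₀, (L w).H)
    (hunr : ∀ n k : ℕ, letI := layerQuotFintype κ n
      haveI := finite_oMuCarrier (K := K) S k
      ∀ (w : HeightOneSpectrum (𝓞 K)) (hw : w ∈ S₀), w ∉ P →
        (L w).proj n k (x ⟨w, hw⟩) ∈ unramifiedSubgroup (GaloisRep.toLocal w (DiscreteGaloisModule.coind (coeffRepK S θ' P k) (κ.layerSubgroup n) (κ.isOpen_layerSubgroup n))) 1)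
    (hx : letI := localAction (closureEmb (K := K) (v.adicCompletion K)) M
      phiLocImage S κ γ θ' P M hstabK PG hPred hM V j S₀ hS₀ ε v (fun _ _ ↦ rfl) hvp L S₁ hS₀S₁ x = 0) :
    ∃ b : I.H, ∀ w : S₀, semilocMap hNP I (L w) b = x w := by
  letI := localAction (closureEmb (K := K) (v.adicCompletion K)) M
  haveI := smulCommClass_localAction (R := padicCoeffIntegers S) M v
  -- totalise `x` by zero off `S₀`
  obtain ⟨h, hh⟩ : ∃ h : ∀ w : HeightOneSpectrum (𝓞 K), (L w).H, ∀ (w : HeightOneSpectrum (𝓞 K)) (hw : w ∈ S₀), h w = x ⟨w, hw⟩ :=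
    ⟨fun w ↦ if hw : w ∈ S₀ then x ⟨w, hw⟩ else 0, fun w hw ↦ dif_pos hw⟩
  have hxh : (fun w : S₀ ↦ h w) = x := funext fun w ↦ hh w w.2
  obtain ⟨b, hb⟩ := exists_forall_semilocMap_eq_of_forall_orth S κ θ' P v M hstabK PG 𝓛 S₀ hS₀ hvS₀ hvP hP hPS₀ hpv hNP hperf I L h
    (fun n k w hw hwP ↦ by rw [hh w hw]; exact hunr n k w hw hwP)
    (fun n k c hcur hcv ↦ sum_semilocPairNK_eq_zero_of_phiLocImage_eq_zero S κ γ θ' P v M hstabK PG hPred hM V j S₀ hS₀ ε hvp hpv L S₁ hS₀S₁ h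
      (by rw [hxh]; exact hx) n k (hperf k) c hcur hcv)
  exact ⟨b, fun w ↦ (hb w w.2).trans (hh w w.2)⟩

end Kernel

end Summit.BirchSwinnertonDyer.BirchSwinnertonDyer.Theorems.SmallImageRttD2Seq

end
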